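import Literature.MathematicalPhysics.QuantumFieldTheory.Balaban1983to89.B11Eq174Chart

/-!
# `Balaban1983to89.B11Eq120SolutionLipschitz` — T. Bałaban, *The variational problem and background fields in renormalization group method for
# lattice gauge theories*, Commun. Math. Phys. **102** (1985) 277–309 [Balaban1985Variational] Prop. 6 (116)–(121) p. 295: THE SOLUTION `𝒜` OF
# (116)/(175) DEPENDS LIPSCHITZ-CONTINUOUSLY ON THE OPERATOR `𝒢` — two regimes with the same scalar letters and `‖𝒢₁f − 𝒢₂f‖ ≤ δ‖f‖` have solutions
# `‖𝒜₁(𝔄) − 𝒜₂(𝔄)‖ ≤ δ·(j + C₄(ε₄ + a)²)/(1 − (θ + 4B₀C₄(ε₄ + a)))`: the contraction estimate (120) turned into a perturbation bound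

statement-level skeleton of published theorems with citation tags; proofs where landed; nothing here is a claim about the Yang–Mills mass gap

PDF held: `paper:balaban1985-cmp102-variational-background` (journal page = PDF page + 276); p. 295 read first-hand on the text layer (2026-08-22):
*«Next, let us investigate when the transformation (116) is contractive. A difference of its values at configurations A₁, A₂ can be written as
[(119)] … The norm max{| |_(−1), |∇ |_(−2)} of this expression can be estimated by [(120)] … Thus the transformation is contractive if [(121)]»*.

WHY THIS FILE (cell context).  The pub-balaban NE9 chain's chart of the curve species `cur U` is lit-balaban's `chartHB 𝔊(U) 0 W 0 (…) ε₄ H₁(U)`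
built on `solA` (`B11Eq174Chart`); gen 81 of the NE9 owner lineage proved that the letters `𝔊(U)`, `H₁(U)` are Lipschitz in the background at the
flat point (`B9Eq386LipschitzH1`, `B9Eq3153FrakGLipschitz`) and that the chart exists on one common ball (`Support/NE9CurChartUniformBall`).  The
CONTINUITY OF THE CHART ITSELF in the background needs the solution's Lipschitz dependence on the operator letter `𝒢` at fixed scalar letters —
this file, abstract; the instantiation (through the U-independent function carrier, since the spaces `Space115 … (∇_U)` vary with `U`) is next.

WHAT IS PROVED (sorry-free; [folklore] contraction-mapping perturbation; no `Prop` placeholder; no inequality of the paper asserted).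
* **`norm_solA_sub_solA_le`** — for `R₁ : Regime 𝒢₁ Λ W B₀ θ C₄ a₃ j a ε₄`, `R₂ : Regime 𝒢₂ Λ W B₀ θ C₄ a₃ j a ε₄` (same `Λ`, `W` and scalar letters),
  data `‖J‖ ≤ j`, `‖𝔄‖ < a` and `‖𝒢₁f − 𝒢₂f‖ ≤ δ‖f‖`:
  `‖solA 𝒢₁ Λ W J ε₄ 𝔄 − solA 𝒢₂ Λ W J ε₄ 𝔄‖ ≤ δ·(j + C₄(ε₄ + a)²)/(1 − (θ + 4B₀C₄(ε₄ + a)))` — fixed points of the two contractions (116)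
  (Lipschitz constant `θ + 4B₀C₄(ε₄ + a) < 1` by (120)/(121), `B11Prop6Scheme.lipschitz_120`) whose maps differ by `δ(‖J‖ + ‖W(X + 𝔄)‖)`.
* **`norm_chartH_sub_chartH_le`** — hence for the chart `chartH 𝒢 Λ W J T ε₄` with a `K`-Lipschitz `T` on the ball of radius `ε₄ + a`:
  `‖chartH 𝒢₁ … 𝔄 − chartH 𝒢₂ … 𝔄‖ ≤ K·δ·(j + C₄(ε₄ + a)²)/(1 − (θ + 4B₀C₄(ε₄ + a)))`.
* **`norm_solA_sub_solA_le_datum`** — `‖𝒜(𝔄₁) − 𝒜(𝔄₂)‖ ≤ κ/(1 − κ)·‖𝔄₁ − 𝔄₂‖` (`κ = θ + 4B₀C₄(ε₄ + a)`): the solution is Lipschitz in the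
  datum (the map depends on `X + 𝔄` only; (120) on the ball of radius `ε₄ + a`); **`norm_chartH_sub_chartH_le_datum`** — the chart is
  `K(κ/(1 − κ) + 1)`-Lipschitz in the datum.
* **`norm_solA_sub_solA_le_general`** / **`norm_chartH_sub_chartH_le_general`** (§3, v1.3) — TWO BACKGROUNDS: all of `𝒢`, `Λ`, `W` (and `T`)
  differ (`δ_G`, `δ_Λ`, `δ_W` on the ball, `δ_T`): `‖𝒜₁ − 𝒜₂‖ ≤ (δ_G(j + C₄′(ε₄ + a)²) + δ_Λ(ε₄ + a) + B₀δ_W)/(1 − κ₁)` — the form the chain's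
  continuity assembly consumes (`W = W80(U)`, `Λ = Λ(U)`, `T = T(U)` move with the background).
ONE ROAD FOR READERS (v1.4 docstring note, A-5 option (α) agreed with NE9 leaf-01 g75 / leaf-02 g58): §3's `norm_solA_sub_solA_le_general` is, in
content, the δ-letter reading of NE9 leaf-01's `B11Eq175SolutionLipschitzLetters.norm_solA_sub_solA_le_letters` (p323564, landed first; defect form,
all three letters `(𝒢, Λ, W)`), certified as a 17-line corollary by leaf-02 g58's `PrereadJunctionL13.lean` 42a82ba8e899b44c — cite either; §1–§2 here
are its `W₁ = W₂`, `Λ₁ = Λ₂` specialisations; the cross-CARRIER form (two (115) norms) is `B11Eq120SolutionContinuity` (gen 82).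
PRIOR ART IN THE TREE (reader ne9-leaf-01 g75, W-ne9leaf01-g75-2): `T4FixedPointResponse` (NE3 P1 lineage) §4 `norm_solution_sub_le_data` / §5
`norm_solution_sub_le_background` prove the perturbation forms of (120) for `mapT` fixed points in full generality (two data; two backgrounds with
`Λ₁ ≠ Λ₂`, `W₁ ≠ W₂`); the statements below are their specialisations AT THE `solA` LEVEL (Regime plumbing included), RE-PROVED here in a few lines
to keep this file's import cone at `B11Eq174Chart` (that file imports `Mathlib` whole + the NE3 response modules) — cf. `T4FixedPointResponse` §4–§5 for
the general forms, which the chain's continuity assembly may import directly when `W = W80(U)`, `C = Cc(U)` move with `U`.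
MODEL / HONEST SCOPE.  Abstract complex normed spaces as in `B11Eq174Chart`; the SAME functional `W`, linear term `Λ` and map `T` for both operators
(the background-dependence of `W`, `T`, `H₁` and of the carriers is NOT treated here); NOT print's statement (print proves existence/uniqueness and
analyticity in `𝔄`; continuity in `𝒢` is the cell's need); NOT summit progress (cell pub-balaban: NE9 NOT PRINTED / NOT PROVED; spine PROVED 0/9).
Filed by the pub-balaban NE9 BINDER-row owner lineage `b2b-balaban-t4-ne9-p1` (gen 81); NEW file importing `B11Eq174Chart` only; nothing modified.
Net new unproved facts: 0.
-/

noncomputable section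

namespace Literature.MathematicalPhysics.QuantumFieldTheory.Balaban1983to89.B11Eq120SolutionLipschitz

open Metric Set
open B13Contraction113 (QuadAnalytic)
open B11Prop6Scheme (mapT mapT_apply lipschitz_120 norm_arg_lt)
open B11Eq174Chart (Regime solA chartH chartH_def)

variable {𝒴 𝒵 : Type*} [NormedAddCommGroup 𝒴] [NormedSpace ℂ 𝒴] [NormedAddCommGroup 𝒵] [NormedSpace ℂ 𝒵] [CompleteSpace 𝒴]
  {𝒢₁ 𝒢₂ : 𝒵 →L[ℂ] 𝒴} {Λ : 𝒴 →L[ℂ] 𝒴} {W : 𝒴 → 𝒵} {B₀ θ C₄ a₃ j a ε₄ : ℝ} {J : 𝒵} {𝔄 : 𝒴} {δ : ℝ}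

/-- **THE SOLUTION OF (116) IS LIPSCHITZ IN THE OPERATOR `𝒢`**: for two regimes with the same scalar letters and `‖𝒢₁f − 𝒢₂f‖ ≤ δ‖f‖`,
`‖𝒜₁(𝔄) − 𝒜₂(𝔄)‖ ≤ δ·(j + C₄(ε₄ + a)²)/(1 − (θ + 4B₀C₄(ε₄ + a)))` — the two fixed points in the ball `‖X‖ ≤ ε₄`: `𝒜₁ − 𝒜₂ = (T₁𝒜₁ − T₁𝒜₂) +
(T₁𝒜₂ − T₂𝒜₂)`, the first term by the contraction estimate (120) (`lipschitz_120`), the second `= (𝒢₂ − 𝒢₁)J + (𝒢₂ − 𝒢₁)(W(𝒜₂ + 𝔄))` bounded by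
`δ(j + C₄(ε₄ + a)²)` (Prop. 4's quadratic bound on the ball of radius `ε₄ + a ≤ a₃/2`). [cite: Balaban1985Variational, Prop. 6 (116)–(121) p.295] -/
theorem norm_solA_sub_solA_le (R₁ : Regime 𝒢₁ Λ W B₀ θ C₄ a₃ j a ε₄) (R₂ : Regime 𝒢₂ Λ W B₀ θ C₄ a₃ j a ε₄) (hJ : ‖J‖ ≤ j) (h𝔄 : ‖𝔄‖ < a)
    (hδ0 : 0 ≤ δ) (hδ : ∀ f, ‖𝒢₁ f - 𝒢₂ f‖ ≤ δ * ‖f‖) :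
    ‖solA 𝒢₁ Λ W J ε₄ 𝔄 - solA 𝒢₂ Λ W J ε₄ 𝔄‖ ≤ δ * (j + C₄ * (ε₄ + a) ^ 2) / (1 - (θ + 4 * B₀ * C₄ * (ε₄ + a))) := by
  obtain ⟨h₁, hfix₁⟩ := R₁.solA_mem hJ h𝔄
  obtain ⟨h₂, hfix₂⟩ := R₂.solA_mem hJ h𝔄
  set X₁ := solA 𝒢₁ Λ W J ε₄ 𝔄 with hX₁
  set X₂ := solA 𝒢₂ Λ W J ε₄ 𝔄 with hX₂
  set κ : ℝ := θ + 4 * B₀ * C₄ * (ε₄ + a) with hκ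
  have hκ1 : κ < 1 := R₁.contr
  have ha : 0 < a := (norm_nonneg _).trans_lt h𝔄
  -- the contraction part
  have hT1 : ‖mapT 𝒢₁ Λ W J 𝔄 X₁ - mapT 𝒢₁ Λ W J 𝔄 X₂‖ ≤ κ * ‖X₁ - X₂‖ :=
    lipschitz_120 (J := J) R₁.norm_G R₁.norm_L R₁.quad R₁.B₀_nonneg R₁.C₄_nonneg h𝔄 R₁.ε₄_nonneg R₁.dom h₁ h₂
  -- the perturbation part: `T₁X₂ − T₂X₂ = (𝒢₂ − 𝒢₁)J + (𝒢₂ − 𝒢₁)(W(X₂ + 𝔄))`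
  have harg : ‖X₂ + 𝔄‖ < ε₄ + a := norm_arg_lt h𝔄 h₂
  have harg3 : ‖X₂ + 𝔄‖ < a₃ := harg.trans_le (by linarith [R₁.dom, R₁.ε₄_nonneg])
  have hW : ‖W (X₂ + 𝔄)‖ ≤ C₄ * (ε₄ + a) ^ 2 :=
    (R₁.quad.quad _ harg3).trans (mul_le_mul_of_nonneg_left (pow_le_pow_left₀ (norm_nonneg _) harg.le 2) R₁.C₄_nonneg)
  have hT2 : ‖mapT 𝒢₁ Λ W J 𝔄 X₂ - mapT 𝒢₂ Λ W J 𝔄 X₂‖ ≤ δ * (j + C₄ * (ε₄ + a) ^ 2) := by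
    have e : mapT 𝒢₁ Λ W J 𝔄 X₂ - mapT 𝒢₂ Λ W J 𝔄 X₂ = -(𝒢₁ J - 𝒢₂ J) - (𝒢₁ (W (X₂ + 𝔄)) - 𝒢₂ (W (X₂ + 𝔄))) := by
      rw [mapT_apply, mapT_apply]; abel
    rw [e]
    calc _ ≤ ‖-(𝒢₁ J - 𝒢₂ J)‖ + ‖𝒢₁ (W (X₂ + 𝔄)) - 𝒢₂ (W (X₂ + 𝔄))‖ := norm_sub_le _ _
      _ ≤ δ * ‖J‖ + δ * ‖W (X₂ + 𝔄)‖ := by rw [norm_neg]; exact add_le_add (hδ _) (hδ _)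
      _ ≤ δ * j + δ * (C₄ * (ε₄ + a) ^ 2) := add_le_add (mul_le_mul_of_nonneg_left hJ hδ0) (mul_le_mul_of_nonneg_left hW hδ0)
      _ = δ * (j + C₄ * (ε₄ + a) ^ 2) := by ring
  -- `X₁ − X₂ = (T₁X₁ − T₁X₂) + (T₁X₂ − T₂X₂)`
  have e : X₁ - X₂ = (mapT 𝒢₁ Λ W J 𝔄 X₁ - mapT 𝒢₁ Λ W J 𝔄 X₂) + (mapT 𝒢₁ Λ W J 𝔄 X₂ - mapT 𝒢₂ Λ W J 𝔄 X₂) := by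
    rw [hfix₁, hfix₂]; abel
  have hmain : ‖X₁ - X₂‖ ≤ κ * ‖X₁ - X₂‖ + δ * (j + C₄ * (ε₄ + a) ^ 2) := by
    calc ‖X₁ - X₂‖ = ‖(mapT 𝒢₁ Λ W J 𝔄 X₁ - mapT 𝒢₁ Λ W J 𝔄 X₂) + (mapT 𝒢₁ Λ W J 𝔄 X₂ - mapT 𝒢₂ Λ W J 𝔄 X₂)‖ := by rw [← e]
      _ ≤ _ := (norm_add_le _ _).trans (add_le_add hT1 hT2)
  have h1κ : 0 < 1 - κ := by linarith
  rw [le_div_iff₀ h1κ]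
  nlinarith [norm_nonneg (X₁ - X₂), hmain]

/-- **HENCE THE CHART (174) IS LIPSCHITZ IN `𝒢`** at a fixed datum: for `T` `K`-Lipschitz on the ball of radius `ε₄ + a`,
`‖chartH 𝒢₁ Λ W J T ε₄ 𝔄 − chartH 𝒢₂ Λ W J T ε₄ 𝔄‖ ≤ K·δ·(j + C₄(ε₄ + a)²)/(1 − (θ + 4B₀C₄(ε₄ + a)))` (`chartH … 𝔄 = T(𝒜(𝔄) + 𝔄)`).
[cite: Balaban1985Variational, (174) p.305, Prop. 6 (120) p.295] -/
theorem norm_chartH_sub_chartH_le {T : 𝒴 → 𝒴} (R₁ : Regime 𝒢₁ Λ W B₀ θ C₄ a₃ j a ε₄) (R₂ : Regime 𝒢₂ Λ W B₀ θ C₄ a₃ j a ε₄)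
    (hJ : ‖J‖ ≤ j) (h𝔄 : ‖𝔄‖ < a) (hδ0 : 0 ≤ δ) (hδ : ∀ f, ‖𝒢₁ f - 𝒢₂ f‖ ≤ δ * ‖f‖) {K : ℝ} (hK : 0 ≤ K)
    (hT : ∀ x y : 𝒴, ‖x‖ < ε₄ + a → ‖y‖ < ε₄ + a → ‖T x - T y‖ ≤ K * ‖x - y‖) :
    ‖chartH 𝒢₁ Λ W J T ε₄ 𝔄 - chartH 𝒢₂ Λ W J T ε₄ 𝔄‖ ≤ K * (δ * (j + C₄ * (ε₄ + a) ^ 2) / (1 - (θ + 4 * B₀ * C₄ * (ε₄ + a)))) := by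
  obtain ⟨h₁, -⟩ := R₁.solA_mem hJ h𝔄
  obtain ⟨h₂, -⟩ := R₂.solA_mem hJ h𝔄
  rw [chartH_def, chartH_def]
  refine (hT _ _ (norm_arg_lt h𝔄 h₁) (norm_arg_lt h𝔄 h₂)).trans (mul_le_mul_of_nonneg_left ?_ hK)
  rw [add_sub_add_right_eq_sub]
  exact norm_solA_sub_solA_le R₁ R₂ hJ h𝔄 hδ0 hδ

/-! ## §2 Lipschitz dependence on the datum `𝔄` -/

/-- **THE SOLUTION OF (116) IS LIPSCHITZ IN THE DATUM `𝔄`**: `‖𝒜(𝔄₁) − 𝒜(𝔄₂)‖ ≤ κ/(1 − κ)·‖𝔄₁ − 𝔄₂‖`, `κ = θ + 4B₀C₄(ε₄ + a)` — since the map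
(116) depends on `X + 𝔄` only, `T_{𝔄₁}X − T_{𝔄₂}X = T₀(X + 𝔄₁) − T₀(X + 𝔄₂)` and the contraction estimate (120) applies on the ball of radius
`ε₄ + a` (the segment's circles stay in the ball of radius `2(ε₄ + a) ≤ a₃`). [cite: Balaban1985Variational, Prop. 6 (119)–(121) p.295] -/
theorem norm_solA_sub_solA_le_datum {𝒢 : 𝒵 →L[ℂ] 𝒴} (R : Regime 𝒢 Λ W B₀ θ C₄ a₃ j a ε₄) (hJ : ‖J‖ ≤ j) {𝔄₁ 𝔄₂ : 𝒴}
    (h𝔄₁ : ‖𝔄₁‖ < a) (h𝔄₂ : ‖𝔄₂‖ < a) :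
    ‖solA 𝒢 Λ W J ε₄ 𝔄₁ - solA 𝒢 Λ W J ε₄ 𝔄₂‖ ≤
      (θ + 4 * B₀ * C₄ * (ε₄ + a)) / (1 - (θ + 4 * B₀ * C₄ * (ε₄ + a))) * ‖𝔄₁ - 𝔄₂‖ := by
  obtain ⟨h₁, hfix₁⟩ := R.solA_mem hJ h𝔄₁
  obtain ⟨h₂, hfix₂⟩ := R.solA_mem hJ h𝔄₂
  set X₁ := solA 𝒢 Λ W J ε₄ 𝔄₁ with hX₁
  set X₂ := solA 𝒢 Λ W J ε₄ 𝔄₂ with hX₂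
  set κ : ℝ := θ + 4 * B₀ * C₄ * (ε₄ + a) with hκ
  have hκ1 : κ < 1 := R.contr
  have hκ0 : 0 ≤ κ := by
    rw [hκ]; have := R.θ_nonneg; have := R.B₀_nonneg; have := R.C₄_nonneg; have := R.ε₄_nonneg
    have ha : 0 < a := (norm_nonneg _).trans_lt h𝔄₁
    positivity
  -- same datum, two points: the contraction estimate (120)
  have hT1 : ‖mapT 𝒢 Λ W J 𝔄₁ X₁ - mapT 𝒢 Λ W J 𝔄₁ X₂‖ ≤ κ * ‖X₁ - X₂‖ :=
    lipschitz_120 (J := J) R.norm_G R.norm_L R.quad R.B₀_nonneg R.C₄_nonneg h𝔄₁ R.ε₄_nonneg R.dom h₁ h₂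
  -- same point, two data: (120) on the ball of radius `ε₄ + a` with datum `0`
  have hP₁ : ‖X₂ + 𝔄₁‖ < ε₄ + a := norm_arg_lt h𝔄₁ h₂
  have hP₂ : ‖X₂ + 𝔄₂‖ < ε₄ + a := norm_arg_lt h𝔄₂ h₂
  obtain ⟨ρ, hρ₁, hρ₂, hρlt⟩ : ∃ ρ : ℝ, ‖X₂ + 𝔄₁‖ ≤ ρ ∧ ‖X₂ + 𝔄₂‖ ≤ ρ ∧ ρ < ε₄ + a :=
    ⟨max ‖X₂ + 𝔄₁‖ ‖X₂ + 𝔄₂‖, le_max_left _ _, le_max_right _ _, max_lt hP₁ hP₂⟩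
  have hρ0 : 0 ≤ ρ := (norm_nonneg _).trans hρ₁
  have hT2 : ‖mapT 𝒢 Λ W J 𝔄₁ X₂ - mapT 𝒢 Λ W J 𝔄₂ X₂‖ ≤ κ * ‖𝔄₁ - 𝔄₂‖ := by
    have e₁ : mapT 𝒢 Λ W J 𝔄₁ X₂ = mapT 𝒢 Λ W J 0 (X₂ + 𝔄₁) := by rw [mapT_apply, mapT_apply, add_zero]
    have e₂ : mapT 𝒢 Λ W J 𝔄₂ X₂ = mapT 𝒢 Λ W J 0 (X₂ + 𝔄₂) := by rw [mapT_apply, mapT_apply, add_zero]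
    have h0 : ‖(0 : 𝒴)‖ < ε₄ + a - ρ := by rw [norm_zero]; linarith
    have hdom' : 2 * (ρ + (ε₄ + a - ρ)) ≤ a₃ := by linarith [R.dom]
    have h := lipschitz_120 (J := J) R.norm_G R.norm_L R.quad R.B₀_nonneg R.C₄_nonneg h0 hρ0 hdom' hρ₁ hρ₂
    rw [e₁, e₂]
    have hring : ρ + (ε₄ + a - ρ) = ε₄ + a := by ring
    rw [hring] at h
    refine h.trans (le_of_eq ?_)
    rw [hκ, add_sub_add_left_eq_sub]
  -- `X₁ − X₂ = (T_{𝔄₁}X₁ − T_{𝔄₁}X₂) + (T_{𝔄₁}X₂ − T_{𝔄₂}X₂)`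
  have e : X₁ - X₂ = (mapT 𝒢 Λ W J 𝔄₁ X₁ - mapT 𝒢 Λ W J 𝔄₁ X₂) + (mapT 𝒢 Λ W J 𝔄₁ X₂ - mapT 𝒢 Λ W J 𝔄₂ X₂) := by
    rw [hfix₁, hfix₂]; abel
  have hmain : ‖X₁ - X₂‖ ≤ κ * ‖X₁ - X₂‖ + κ * ‖𝔄₁ - 𝔄₂‖ := by
    calc ‖X₁ - X₂‖ = ‖(mapT 𝒢 Λ W J 𝔄₁ X₁ - mapT 𝒢 Λ W J 𝔄₁ X₂) + (mapT 𝒢 Λ W J 𝔄₁ X₂ - mapT 𝒢 Λ W J 𝔄₂ X₂)‖ := by rw [← e]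
      _ ≤ _ := (norm_add_le _ _).trans (add_le_add hT1 hT2)
  have h1κ : 0 < 1 - κ := by linarith
  rw [div_mul_eq_mul_div, le_div_iff₀ h1κ]
  nlinarith [norm_nonneg (X₁ - X₂), norm_nonneg (𝔄₁ - 𝔄₂), hmain]

/-- **HENCE THE CHART (174) IS LIPSCHITZ IN THE DATUM**: for `T` `K`-Lipschitz on the ball of radius `ε₄ + a`,
`‖chartH … 𝔄₁ − chartH … 𝔄₂‖ ≤ K·(κ/(1 − κ) + 1)·‖𝔄₁ − 𝔄₂‖` (`chartH … 𝔄 = T(𝒜(𝔄) + 𝔄)`). [cite: Balaban1985Variational, (174) p.305, Prop. 6 (120) p.295] -/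
theorem norm_chartH_sub_chartH_le_datum {𝒢 : 𝒵 →L[ℂ] 𝒴} {T : 𝒴 → 𝒴} (R : Regime 𝒢 Λ W B₀ θ C₄ a₃ j a ε₄) (hJ : ‖J‖ ≤ j)
    {𝔄₁ 𝔄₂ : 𝒴} (h𝔄₁ : ‖𝔄₁‖ < a) (h𝔄₂ : ‖𝔄₂‖ < a) {K : ℝ} (hK : 0 ≤ K)
    (hT : ∀ x y : 𝒴, ‖x‖ < ε₄ + a → ‖y‖ < ε₄ + a → ‖T x - T y‖ ≤ K * ‖x - y‖) :
    ‖chartH 𝒢 Λ W J T ε₄ 𝔄₁ - chartH 𝒢 Λ W J T ε₄ 𝔄₂‖ ≤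
      K * ((θ + 4 * B₀ * C₄ * (ε₄ + a)) / (1 - (θ + 4 * B₀ * C₄ * (ε₄ + a))) + 1) * ‖𝔄₁ - 𝔄₂‖ := by
  obtain ⟨h₁, -⟩ := R.solA_mem hJ h𝔄₁
  obtain ⟨h₂, -⟩ := R.solA_mem hJ h𝔄₂
  rw [chartH_def, chartH_def]
  refine (hT _ _ (norm_arg_lt h𝔄₁ h₁) (norm_arg_lt h𝔄₂ h₂)).trans ?_
  rw [mul_assoc]
  refine mul_le_mul_of_nonneg_left ?_ hK
  have hs := norm_solA_sub_solA_le_datum R hJ h𝔄₁ h𝔄₂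
  calc ‖solA 𝒢 Λ W J ε₄ 𝔄₁ + 𝔄₁ - (solA 𝒢 Λ W J ε₄ 𝔄₂ + 𝔄₂)‖
      = ‖(solA 𝒢 Λ W J ε₄ 𝔄₁ - solA 𝒢 Λ W J ε₄ 𝔄₂) + (𝔄₁ - 𝔄₂)‖ := by congr 1; abel
    _ ≤ ‖solA 𝒢 Λ W J ε₄ 𝔄₁ - solA 𝒢 Λ W J ε₄ 𝔄₂‖ + ‖𝔄₁ - 𝔄₂‖ := norm_add_le _ _
    _ ≤ (θ + 4 * B₀ * C₄ * (ε₄ + a)) / (1 - (θ + 4 * B₀ * C₄ * (ε₄ + a))) * ‖𝔄₁ - 𝔄₂‖ + ‖𝔄₁ - 𝔄₂‖ := add_le_add hs le_rfl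
    _ = _ := by ring

/-! ## §3 Two backgrounds: all three letters `𝒢`, `Λ`, `W` (and the map `T`) may differ -/

/-- **GENERAL FORM — TWO BACKGROUNDS**: regimes `R₁ = (𝒢₁, Λ₁, W₁; B₀, θ, C₄, a₃, j)` and `R₂ = (𝒢₂, Λ₂, W₂; B₀′, θ′, C₄′, a₃′, j′)` on the SAME
ball (`a`, `ε₄`), common data `(J, 𝔄)`; with `‖(𝒢₁ − 𝒢₂)f‖ ≤ δ_G‖f‖`, `‖(Λ₁ − Λ₂)y‖ ≤ δ_Λ‖y‖`, `‖W₁P − W₂P‖ ≤ δ_W` on `‖P‖ < ε₄ + a`: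
`‖𝒜₁ − 𝒜₂‖ ≤ (δ_G(j + C₄′(ε₄ + a)²) + δ_Λ(ε₄ + a) + B₀δ_W)/(1 − κ₁)`, `κ₁ = θ + 4B₀C₄(ε₄ + a)` — since `T₁𝒜₂ − T₂𝒜₂ = −(𝒢₁ − 𝒢₂)J +
(Λ₁ − Λ₂)P − 𝒢₁(W₁P − W₂P) − (𝒢₁ − 𝒢₂)(W₂P)`, `P = 𝒜₂ + 𝔄`.  (The form the chain's continuity assembly needs: `W = W80(U)` and the (115)
letters move with `U`; cf. `T4FixedPointResponse.norm_solution_sub_le_background` at the `mapT` level.) [cite: Balaban1985Variational, Prop. 6 (116)–(121) p.295] -/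
theorem norm_solA_sub_solA_le_general {Λ₁ Λ₂ : 𝒴 →L[ℂ] 𝒴} {W₁ W₂ : 𝒴 → 𝒵} {B₀' θ' C₄' a₃' j' δG δΛ δW : ℝ}
    (R₁ : Regime 𝒢₁ Λ₁ W₁ B₀ θ C₄ a₃ j a ε₄) (R₂ : Regime 𝒢₂ Λ₂ W₂ B₀' θ' C₄' a₃' j' a ε₄) (hJ : ‖J‖ ≤ j) (hJ' : ‖J‖ ≤ j')
    (h𝔄 : ‖𝔄‖ < a) (hδG0 : 0 ≤ δG) (hδΛ0 : 0 ≤ δΛ) (hδG : ∀ f, ‖𝒢₁ f - 𝒢₂ f‖ ≤ δG * ‖f‖) (hδΛ : ∀ y, ‖Λ₁ y - Λ₂ y‖ ≤ δΛ * ‖y‖)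
    (hδW : ∀ P : 𝒴, ‖P‖ < ε₄ + a → ‖W₁ P - W₂ P‖ ≤ δW) :
    ‖solA 𝒢₁ Λ₁ W₁ J ε₄ 𝔄 - solA 𝒢₂ Λ₂ W₂ J ε₄ 𝔄‖ ≤
      (δG * (j + C₄' * (ε₄ + a) ^ 2) + δΛ * (ε₄ + a) + B₀ * δW) / (1 - (θ + 4 * B₀ * C₄ * (ε₄ + a))) := by
  obtain ⟨h₁, hfix₁⟩ := R₁.solA_mem hJ h𝔄
  obtain ⟨h₂, hfix₂⟩ := R₂.solA_mem hJ' h𝔄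
  set X₁ := solA 𝒢₁ Λ₁ W₁ J ε₄ 𝔄 with hX₁
  set X₂ := solA 𝒢₂ Λ₂ W₂ J ε₄ 𝔄 with hX₂
  set κ : ℝ := θ + 4 * B₀ * C₄ * (ε₄ + a) with hκ
  have hκ1 : κ < 1 := R₁.contr
  -- the contraction part (regime 1)
  have hT1 : ‖mapT 𝒢₁ Λ₁ W₁ J 𝔄 X₁ - mapT 𝒢₁ Λ₁ W₁ J 𝔄 X₂‖ ≤ κ * ‖X₁ - X₂‖ :=
    lipschitz_120 (J := J) R₁.norm_G R₁.norm_L R₁.quad R₁.B₀_nonneg R₁.C₄_nonneg h𝔄 R₁.ε₄_nonneg R₁.dom h₁ h₂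
  -- the perturbation part at the second solution
  set P : 𝒴 := X₂ + 𝔄 with hP
  have harg : ‖P‖ < ε₄ + a := norm_arg_lt h𝔄 h₂
  have ha : 0 < a := (norm_nonneg _).trans_lt h𝔄
  have harg3 : ‖P‖ < a₃' := harg.trans_le (by linarith [R₂.dom, R₂.ε₄_nonneg])
  have hW₂ : ‖W₂ P‖ ≤ C₄' * (ε₄ + a) ^ 2 :=
    (R₂.quad.quad _ harg3).trans (mul_le_mul_of_nonneg_left (pow_le_pow_left₀ (norm_nonneg _) harg.le 2) R₂.C₄_nonneg)
  have hT2 : ‖mapT 𝒢₁ Λ₁ W₁ J 𝔄 X₂ - mapT 𝒢₂ Λ₂ W₂ J 𝔄 X₂‖ ≤ δG * (j + C₄' * (ε₄ + a) ^ 2) + δΛ * (ε₄ + a) + B₀ * δW := by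
    have e : mapT 𝒢₁ Λ₁ W₁ J 𝔄 X₂ - mapT 𝒢₂ Λ₂ W₂ J 𝔄 X₂ =
        -(𝒢₁ J - 𝒢₂ J) + (Λ₁ P - Λ₂ P) - 𝒢₁ (W₁ P - W₂ P) - (𝒢₁ (W₂ P) - 𝒢₂ (W₂ P)) := by
      rw [mapT_apply, mapT_apply, map_sub]; abel
    rw [e]
    have i1 : ‖-(𝒢₁ J - 𝒢₂ J)‖ ≤ δG * j := by
      rw [norm_neg]; exact (hδG _).trans (mul_le_mul_of_nonneg_left hJ hδG0)
    have i2 : ‖Λ₁ P - Λ₂ P‖ ≤ δΛ * (ε₄ + a) := (hδΛ _).trans (mul_le_mul_of_nonneg_left harg.le hδΛ0)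
    have i3 : ‖𝒢₁ (W₁ P - W₂ P)‖ ≤ B₀ * δW := (R₁.norm_G _).trans (mul_le_mul_of_nonneg_left (hδW _ harg) R₁.B₀_nonneg)
    have i4 : ‖𝒢₁ (W₂ P) - 𝒢₂ (W₂ P)‖ ≤ δG * (C₄' * (ε₄ + a) ^ 2) := (hδG _).trans (mul_le_mul_of_nonneg_left hW₂ hδG0)
    calc _ ≤ ‖-(𝒢₁ J - 𝒢₂ J) + (Λ₁ P - Λ₂ P) - 𝒢₁ (W₁ P - W₂ P)‖ + ‖𝒢₁ (W₂ P) - 𝒢₂ (W₂ P)‖ := norm_sub_le _ _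
      _ ≤ ‖-(𝒢₁ J - 𝒢₂ J) + (Λ₁ P - Λ₂ P)‖ + ‖𝒢₁ (W₁ P - W₂ P)‖ + ‖𝒢₁ (W₂ P) - 𝒢₂ (W₂ P)‖ :=
          add_le_add (norm_sub_le _ _) le_rfl
      _ ≤ ‖-(𝒢₁ J - 𝒢₂ J)‖ + ‖Λ₁ P - Λ₂ P‖ + ‖𝒢₁ (W₁ P - W₂ P)‖ + ‖𝒢₁ (W₂ P) - 𝒢₂ (W₂ P)‖ :=
          add_le_add (add_le_add (norm_add_le _ _) le_rfl) le_rfl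
      _ ≤ δG * j + δΛ * (ε₄ + a) + B₀ * δW + δG * (C₄' * (ε₄ + a) ^ 2) := add_le_add (add_le_add (add_le_add i1 i2) i3) i4
      _ = _ := by ring
  -- `X₁ − X₂ = (T₁X₁ − T₁X₂) + (T₁X₂ − T₂X₂)`
  have e : X₁ - X₂ = (mapT 𝒢₁ Λ₁ W₁ J 𝔄 X₁ - mapT 𝒢₁ Λ₁ W₁ J 𝔄 X₂) + (mapT 𝒢₁ Λ₁ W₁ J 𝔄 X₂ - mapT 𝒢₂ Λ₂ W₂ J 𝔄 X₂) := by
    rw [hfix₁, hfix₂]; abel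
  have hmain : ‖X₁ - X₂‖ ≤ κ * ‖X₁ - X₂‖ + (δG * (j + C₄' * (ε₄ + a) ^ 2) + δΛ * (ε₄ + a) + B₀ * δW) := by
    calc ‖X₁ - X₂‖ = ‖(mapT 𝒢₁ Λ₁ W₁ J 𝔄 X₁ - mapT 𝒢₁ Λ₁ W₁ J 𝔄 X₂) + (mapT 𝒢₁ Λ₁ W₁ J 𝔄 X₂ - mapT 𝒢₂ Λ₂ W₂ J 𝔄 X₂)‖ := by
          rw [← e]
      _ ≤ _ := (norm_add_le _ _).trans (add_le_add hT1 hT2)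
  have h1κ : 0 < 1 - κ := by linarith
  rw [le_div_iff₀ h1κ]
  nlinarith [norm_nonneg (X₁ - X₂), hmain]

/-- **… AND THE CHART (174) WITH TWO MAPS `T₁`, `T₂`**: if `‖T₁x − T₂y‖ ≤ K‖x − y‖ + δ_T` on the ball of radius `ε₄ + a`, then
`‖chartH 𝒢₁ Λ₁ W₁ J T₁ ε₄ 𝔄 − chartH 𝒢₂ Λ₂ W₂ J T₂ ε₄ 𝔄‖ ≤ K·(δ_G(j + C₄′(ε₄ + a)²) + δ_Λ(ε₄ + a) + B₀δ_W)/(1 − κ₁) + δ_T`.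
[cite: Balaban1985Variational, (174) p.305, Prop. 6 (120) p.295] -/
theorem norm_chartH_sub_chartH_le_general {Λ₁ Λ₂ : 𝒴 →L[ℂ] 𝒴} {W₁ W₂ : 𝒴 → 𝒵} {T₁ T₂ : 𝒴 → 𝒴}
    {B₀' θ' C₄' a₃' j' δG δΛ δW δT K : ℝ}
    (R₁ : Regime 𝒢₁ Λ₁ W₁ B₀ θ C₄ a₃ j a ε₄) (R₂ : Regime 𝒢₂ Λ₂ W₂ B₀' θ' C₄' a₃' j' a ε₄) (hJ : ‖J‖ ≤ j) (hJ' : ‖J‖ ≤ j')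
    (h𝔄 : ‖𝔄‖ < a) (hδG0 : 0 ≤ δG) (hδΛ0 : 0 ≤ δΛ) (hδG : ∀ f, ‖𝒢₁ f - 𝒢₂ f‖ ≤ δG * ‖f‖) (hδΛ : ∀ y, ‖Λ₁ y - Λ₂ y‖ ≤ δΛ * ‖y‖)
    (hδW : ∀ P : 𝒴, ‖P‖ < ε₄ + a → ‖W₁ P - W₂ P‖ ≤ δW) (hK : 0 ≤ K)
    (hT : ∀ x y : 𝒴, ‖x‖ < ε₄ + a → ‖y‖ < ε₄ + a → ‖T₁ x - T₂ y‖ ≤ K * ‖x - y‖ + δT) :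
    ‖chartH 𝒢₁ Λ₁ W₁ J T₁ ε₄ 𝔄 - chartH 𝒢₂ Λ₂ W₂ J T₂ ε₄ 𝔄‖ ≤
      K * ((δG * (j + C₄' * (ε₄ + a) ^ 2) + δΛ * (ε₄ + a) + B₀ * δW) / (1 - (θ + 4 * B₀ * C₄ * (ε₄ + a)))) + δT := by
  obtain ⟨h₁, -⟩ := R₁.solA_mem hJ h𝔄
  obtain ⟨h₂, -⟩ := R₂.solA_mem hJ' h𝔄
  rw [chartH_def, chartH_def]
  refine (hT _ _ (norm_arg_lt h𝔄 h₁) (norm_arg_lt h𝔄 h₂)).trans (add_le_add (mul_le_mul_of_nonneg_left ?_ hK) le_rfl)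
  rw [add_sub_add_right_eq_sub]
  exact norm_solA_sub_solA_le_general R₁ R₂ hJ hJ' h𝔄 hδG0 hδΛ0 hδG hδΛ hδW

end Literature.MathematicalPhysics.QuantumFieldTheory.Balaban1983to89.B11Eq120SolutionLipschitz

end
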